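import Summits.HubbardSuperconductivity.HubbardSuperconductivity.Theorems.AnisotropyChordTransferFibre3L2SlopeEval
import Summits.HubbardSuperconductivity.HubbardSuperconductivity.Theorems.AnisotropyChordTransferFibre3N1RowCheckC

/-!
# Route `AnisotropyChord` / H0 rotor rung, LEVEL 2 row `N₁`: the FIRST-ORDER cell checker and its soundness (interval layer)

The `(ν, a)`-cells of the ∀L ≥ 128 row-`N₁` certificate (`…N1RowCheckC`, zero order) lose 0.07–0.11 of `c₁″` to interval
decorrelation in `(ν, a)` (measured on the Δ ≈ 0.6 cell `ν ∈ [.02088, .021715] × a ∈ [.2667, .30]`: ∀L point value 0.586, cell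
value 0.478).  This file evaluates the SAME object brackets (`objSpecsC`) and the SAME assembly (`marginE`, `fP`, `UpE`) with the
slope evaluator of `…L2SlopeEval`, the two moving coordinates being `ν` (index 2) and `a` (index 3) with centres at the cell
midpoints: stage-1 environment `envC B` of the staged box, END data of the ten bracket ends (`endCheckS` on the cell /
`endCheckB` on a LITERAL copy of the staged box — one kernel `decide` per end or per PART of an end, literal data from the
compiled evaluator, containment `SDincl`), object data = hulls of the end pairs (`holdsHull_of_between`), final-stage
environment `envF`, and the FINAL CHECK `finalCheckS/finalCheckB`: centred upper bounds of `cmin·U′ − N₁′`, `1 − P̂`, `1 − U′`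
are `≤ 0`.  Soundness: `EndHolds` (semantic end condition; from a check, or assembled: `endHolds_add/sub/neg/cons/append/
chunks`), ★★ `cellCheckS_sound` — the same conclusion as `n1CellCheckC_sound` (so `…N1RowCellSound` applies verbatim, see
`…N1RowCellSoundS`).  On the cell above the first-order check certifies `cmin = 0.575` (zero order: 0.45).
Prover seat `hubbard-h0-rotor-p2` g6; helper for piece A = stmt-HubbardSuperconductivity-23918 of rung 19089
(`--supports`, helper class).  Nothing here proves superconductivity in the Hubbard model; generic helper lemmas serving ONE
conditional reduction (the GM₃ ∀L certificate, Level-2 row `N₁`); the rotor TARGET as originally worded stays FALSE (g15 verdict).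
Mathlib + the tree only; no sorry.
-/

set_option linter.dupNamespace false
set_option autoImplicit false

namespace Summit.HubbardSuperconductivity.HubbardSuperconductivity.Theorems.AnisotropyChord.Transfer.Fibre3.L2.N1

open Summit.HubbardSuperconductivity.HubbardSuperconductivity.Theorems.AnisotropyChord.Transfer.Fibre3.L2
open Literature.Analysis.ValidatedNumerics NonemptyInterval

/-! ## The first-order cell checker (computable) -/

/-- midpoint of an interval. -/
def midI (I : NonemptyInterval ℚ) : ℚ := (I.fst + I.snd) / 2
/-- the increments interval `I − q = [lo − q, hi − q]`. -/
def incrI (I : NonemptyInterval ℚ) (q : ℚ) : NonemptyInterval ℚ := I - pure q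
/-- interval containment as a `Bool`. -/
def inclB (I J : NonemptyInterval ℚ) : Bool := decide (J.fst ≤ I.fst) && decide (I.snd ≤ J.snd)
/-- componentwise containment of slope data. -/
def SDincl (A D : SD) : Bool := inclB A.c D.c && inclB A.r D.r && inclB A.s2 D.s2 && inclB A.s3 D.s3 && inclB A.e D.e

/-- interval literal (smart constructor, no proof obligation: the degenerate case collapses to a point). -/
def ivQ (lo hi : ℚ) : NonemptyInterval ℚ := if h : lo ≤ hi then ⟨(lo, hi), h⟩ else pure lo
/-- slope-datum literal from ten rationals. -/
def sdQ (c1 c2 r1 r2 s1 s2 t1 t2 e1 e2 : ℚ) : SD := ⟨ivQ c1 c2, ivQ r1 r2, ivQ s1 s2, ivQ t1 t2, ivQ e1 e2⟩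

/-- stage-1 slope environment of a staged box: coordinate `2` (`ν`, centre `ν₀`) and `3` (`a`, centre `a₀`) move, every
other coordinate is still. -/
def envS (B : Box) (nu0 a0 : ℚ) : ℕ → SD := fun i =>
  if i = 2 then SD.mov2 nu0 (B.toIvl 2) else if i = 3 then SD.mov3 a0 (B.toIvl 3) else SD.still (B.toIvl i)
/-- the centred stage-1 environment of a cell's staged box (centres = midpoints). -/
def envC (B : Box) : ℕ → SD := envS B (midI (B.toIvl 2)) (midI (B.toIvl 3))
/-- final-stage environment `(t, π², ν, a, ê₁, objects…)` from the stage-1 environment and the object data. -/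
def envF (XS : ℕ → SD) (objs : List SD) : ℕ → SD := fun i =>
  if i < 4 then XS i else if i = 4 then XS 16 else objs.getD (i - 5) (SD.const 0)

/-- ★ END CHECK: the slope datum of the bracket end `e` on the cell's staged box is contained in the literal `D`
(one kernel `decide` per object end; the literal is produced by the compiled evaluator). -/
def endCheckS (c : L2.NamedCell) (a1 a2 : ℚ) (M2 : ℕ) (pi : ℕ × ℕ) (e : RExpr) (D : SD) : Bool :=
  match cellBox c a1 a2 M2 pi with
  | none => false
  | some B =>
    match sdEnclose pi.1 pi.2 (envC B) e with
    | none => false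
    | some A => SDincl A D

/-- ★ FINAL CHECK: with the object data `ends` (pairs of end data; object datum = hull of the pair), the centred upper
bounds of `cmin·U′ − N₁′`, `−P̂ + 1`, `−U′ + 1` are `≤ 0` on the cell. -/
def finalCheckS (c : L2.NamedCell) (a1 a2 : ℚ) (M2 : ℕ) (pi : ℕ × ℕ) (ends : List (SD × SD)) (cmin : ℚ) : Bool :=
  match cellBox c a1 a2 M2 pi with
  | none => false
  | some B =>
    let XF := envF (envC B) (ends.map fun p => p.1.hull p.2)
    let D2 := incrI (B.toIvl 2) (midI (B.toIvl 2))
    let D3 := incrI (B.toIvl 3) (midI (B.toIvl 3))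
    match sdEnclose pi.1 pi.2 XF (marginE cmin), sdEnclose pi.1 pi.2 XF (.neg fP), sdEnclose pi.1 pi.2 XF (.neg UpE) with
    | some M, some P, some U => decide (M.ub D2 D3 ≤ 0) && decide (P.ub D2 D3 ≤ -1) && decide (U.ub D2 D3 ≤ -1)
    | _, _, _ => false

/-! ## Soundness of the interval layer -/

/-- containment transfers membership. -/
theorem mem_of_inclB {I J : NonemptyInterval ℚ} {x : ℝ} (h : inclB I J = true) (hx : x ∈ I.ratCast ℝ) :
    x ∈ J.ratCast ℝ := by
  simp only [inclB, Bool.and_eq_true, decide_eq_true_eq] at h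
  rw [memQ] at hx ⊢
  exact ⟨le_trans (by exact_mod_cast h.1) hx.1, hx.2.trans (by exact_mod_cast h.2)⟩

/-- containment transfers slope data. -/
theorem holds_of_SDincl {A D : SD} {δ2 δ3 fx fz : ℝ} (h : SDincl A D = true) (hA : A.Holds δ2 δ3 fx fz) :
    D.Holds δ2 δ3 fx fz := by
  simp only [SDincl, Bool.and_eq_true] at h
  obtain ⟨⟨⟨⟨hc, hr⟩, h2⟩, h3⟩, he⟩ := h
  obtain ⟨a2, ha2, a3, ha3, ar, har, ha⟩ := hA.lin
  exact ⟨mem_of_inclB hc hA.memc, mem_of_inclB hr hA.memr,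
    ⟨a2, mem_of_inclB h2 ha2, a3, mem_of_inclB h3 ha3, ar, mem_of_inclB he har, ha⟩⟩

/-- the midpoint lies in the interval. -/
theorem midI_mem (I : NonemptyInterval ℚ) : ((midI I : ℚ) : ℝ) ∈ I.ratCast ℝ := by
  rw [memQ]; unfold midI
  have h : (I.fst : ℝ) ≤ I.snd := by exact_mod_cast I.fst_le_snd
  constructor <;> push_cast <;> linarith

/-- the centre point of the stage-1 pair: `x` with coordinates `2, 3` replaced by the centres. -/
noncomputable def cenPt (B : Box) (x : ℕ → ℝ) : ℕ → ℝ :=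
  Function.update (Function.update x 2 ((midI (B.toIvl 2) : ℚ) : ℝ)) 3 ((midI (B.toIvl 3) : ℚ) : ℝ)

/-- ★ the centred stage-1 environment encloses the pair `(x, cenPt B x)` for every point `x` of the box, with increments
`δ₂ = x₂ − ν₀`, `δ₃ = x₃ − a₀`. -/
theorem holds_envC {B : Box} {x : ℕ → ℝ} (hx : B.mem x) (i : ℕ) :
    (envC B i).Holds (x 2 - midI (B.toIvl 2)) (x 3 - midI (B.toIvl 3)) (x i) (cenPt B x i) := by
  unfold envC envS cenPt
  by_cases h2 : i = 2
  · subst h2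
    simp only [if_true, Function.update_of_ne (show (2:ℕ) ≠ 3 by decide), Function.update_self]
    exact SD.mov2_holds (Box.mem_toIvl hx 2) rfl
  · by_cases h3 : i = 3
    · subst h3
      simp only [show (3:ℕ) ≠ 2 by decide, if_false, if_true, Function.update_self]
      exact SD.mov3_holds (Box.mem_toIvl hx 3) rfl
    · simp only [h2, h3, if_false, Function.update_of_ne h3, Function.update_of_ne h2]
      exact SD.still_holds (Box.mem_toIvl hx i)

/-- the increments lie in the increments intervals. -/
theorem incr_mem {B : Box} {x : ℕ → ℝ} (hx : B.mem x) (i : ℕ) :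
    x i - midI (B.toIvl i) ∈ (incrI (B.toIvl i) (midI (B.toIvl i))).ratCast ℝ := by
  unfold incrI
  exact isSoundFun₂_sub (Box.mem_toIvl hx i) (mem_pureQ _)

/-- ★ soundness of one END CHECK: the literal datum encloses the pair of values of the end term at `(x, cenPt B x)`. -/
theorem endCheckS_sound {c : L2.NamedCell} {a1 a2 : ℚ} {M2 : ℕ} {pi : ℕ × ℕ} {e : RExpr} {D : SD} {B : Box}
    (h : endCheckS c a1 a2 M2 pi e D = true) (hB : cellBox c a1 a2 M2 pi = some B) {x : ℕ → ℝ} (hx : B.mem x) :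
    D.Holds (x 2 - midI (B.toIvl 2)) (x 3 - midI (B.toIvl 3)) (e.eval x) (e.eval (cenPt B x)) := by
  unfold endCheckS at h
  rw [hB] at h
  simp only at h
  split at h
  · exact absurd h (by simp)
  · rename_i A hA
    exact holds_of_SDincl h (sdEnclose_sound (holds_envC hx) e hA)

/-- ★ the SEMANTIC END CONDITION: the datum `D` encloses the end term `e` at every pair `(x, cenPt B x)` of the cell's staged
box (discharged by one `endCheckS`, or assembled from parts by `endHolds_cons`). -/
def EndHolds (c : L2.NamedCell) (a1 a2 : ℚ) (M2 : ℕ) (pi : ℕ × ℕ) (e : RExpr) (D : SD) : Prop :=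
  ∀ B, cellBox c a1 a2 M2 pi = some B → ∀ x : ℕ → ℝ, B.mem x →
    D.Holds (x 2 - midI (B.toIvl 2)) (x 3 - midI (B.toIvl 3)) (e.eval x) (e.eval (cenPt B x))

/-- ★ a passing end check gives the end condition. -/
theorem endHolds_of_check {c : L2.NamedCell} {a1 a2 : ℚ} {M2 : ℕ} {pi : ℕ × ℕ} {e : RExpr} {D : SD}
    (h : endCheckS c a1 a2 M2 pi e D = true) : EndHolds c a1 a2 M2 pi e D :=
  fun _ hB _ hx => endCheckS_sound h hB hx

/-- a singleton sum is its term. -/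
theorem endHolds_single {c : L2.NamedCell} {a1 a2 : ℚ} {M2 : ℕ} {pi : ℕ × ℕ} {e : RExpr} {D : SD}
    (h : EndHolds c a1 a2 M2 pi e D) : EndHolds c a1 a2 M2 pi (rsum [e]) D := h

/-- ★ PARTS: the end condition of a sum `rsum (e :: e′ :: l)` from the end conditions of `e` and of `rsum (e′ :: l)` (used to
split a heavy end term over several kernel checks). -/
theorem endHolds_cons {c : L2.NamedCell} {a1 a2 : ℚ} {M2 : ℕ} {pi : ℕ × ℕ} (prec : ℕ) {e e' : RExpr} {l : List RExpr}
    {D D' : SD} (h : EndHolds c a1 a2 M2 pi e D) (h' : EndHolds c a1 a2 M2 pi (rsum (e' :: l)) D') :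
    EndHolds c a1 a2 M2 pi (rsum (e :: e' :: l)) (D.add prec D') :=
  fun B hB x hx => by
    have := SD.add_holds prec (h B hB x hx) (h' B hB x hx)
    simpa [rsum, RExpr.eval] using this

/-- end condition of a sum node. -/
theorem endHolds_add {c : L2.NamedCell} {a1 a2 : ℚ} {M2 : ℕ} {pi : ℕ × ℕ} (prec : ℕ) {e e' : RExpr} {D D' : SD}
    (h : EndHolds c a1 a2 M2 pi e D) (h' : EndHolds c a1 a2 M2 pi e' D') :
    EndHolds c a1 a2 M2 pi (.add e e') (D.add prec D') :=
  fun B hB x hx => SD.add_holds prec (h B hB x hx) (h' B hB x hx)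

/-- end condition of a difference node. -/
theorem endHolds_sub {c : L2.NamedCell} {a1 a2 : ℚ} {M2 : ℕ} {pi : ℕ × ℕ} (prec : ℕ) {e e' : RExpr} {D D' : SD}
    (h : EndHolds c a1 a2 M2 pi e D) (h' : EndHolds c a1 a2 M2 pi e' D') :
    EndHolds c a1 a2 M2 pi (.sub e e') (D.sub prec D') :=
  fun B hB x hx => SD.sub_holds prec (h B hB x hx) (h' B hB x hx)

/-- end condition of a negation node. -/
theorem endHolds_neg {c : L2.NamedCell} {a1 a2 : ℚ} {M2 : ℕ} {pi : ℕ × ℕ} {e : RExpr} {D : SD}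
    (h : EndHolds c a1 a2 M2 pi e D) : EndHolds c a1 a2 M2 pi (.neg e) D.neg :=
  fun B hB x hx => SD.neg_holds (h B hB x hx)

/-- the value of `rsum (l₁ ++ l₂)` is the sum of the values. -/
theorem eval_rsum_append (x : ℕ → ℝ) : ∀ (l₁ l₂ : List RExpr),
    (rsum (l₁ ++ l₂)).eval x = (rsum l₁).eval x + (rsum l₂).eval x
  | [], l₂ => by simp [rsum, RExpr.eval]
  | [e], [] => by simp [rsum, RExpr.eval]
  | [e], e' :: l₂ => by simp [rsum, RExpr.eval]
  | e :: e' :: l₁, l₂ => by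
    have := eval_rsum_append x (e' :: l₁) l₂
    simp only [List.cons_append] at this ⊢
    simp only [rsum, RExpr.eval] at this ⊢
    rw [this]; ring

/-- ★ APPEND: the end condition of `rsum (l₁ ++ l₂)` from those of `rsum l₁` and `rsum l₂`. -/
theorem endHolds_append {c : L2.NamedCell} {a1 a2 : ℚ} {M2 : ℕ} {pi : ℕ × ℕ} (prec : ℕ) (l₁ l₂ : List RExpr)
    {D D' : SD} (h : EndHolds c a1 a2 M2 pi (rsum l₁) D) (h' : EndHolds c a1 a2 M2 pi (rsum l₂) D') :
    EndHolds c a1 a2 M2 pi (rsum (l₁ ++ l₂)) (D.add prec D') :=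
  fun B hB x hx => by
    rw [eval_rsum_append, eval_rsum_append]
    exact SD.add_holds prec (h B hB x hx) (h' B hB x hx)

/-- ★ CHUNKS: the end condition of `rsum (l.map f)` from those of the two chunks `l.take k`, `l.drop k` (used to split a long
block sum over several kernel checks). -/
theorem endHolds_chunks {c : L2.NamedCell} {a1 a2 : ℚ} {M2 : ℕ} {pi : ℕ × ℕ} (prec : ℕ) {α : Type} (l : List α)
    (f : α → RExpr) (k : ℕ) {D D' : SD} (h : EndHolds c a1 a2 M2 pi (rsum ((l.take k).map f)) D)
    (h' : EndHolds c a1 a2 M2 pi (rsum ((l.drop k).map f)) D') :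
    EndHolds c a1 a2 M2 pi (rsum (l.map f)) (D.add prec D') :=
  fun B hB x hx => by
    have e1 : (rsum (l.map f)).eval x = (rsum ((l.take k).map f)).eval x + (rsum ((l.drop k).map f)).eval x := by
      rw [← eval_rsum_append, ← List.map_append, List.take_append_drop]
    have e2 : (rsum (l.map f)).eval (cenPt B x) =
        (rsum ((l.take k).map f)).eval (cenPt B x) + (rsum ((l.drop k).map f)).eval (cenPt B x) := by
      rw [← eval_rsum_append, ← List.map_append, List.take_append_drop]
    rw [e1, e2]
    exact SD.add_holds prec (h B hB x hx) (h' B hB x hx)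

/-- ★ END CHECK ON A LITERAL STAGED BOX (the cell's `cellBox`, computed once by the kernel and recorded as a literal): the slope
datum of `e` on `B` is contained in `D`. -/
def endCheckB (B : Box) (pi : ℕ × ℕ) (e : RExpr) (D : SD) : Bool :=
  match sdEnclose pi.1 pi.2 (envC B) e with
  | none => false
  | some A => SDincl A D

/-- ★ a passing literal-box end check gives the end condition, once the literal IS the cell's staged box. -/
theorem endHolds_of_checkB {c : L2.NamedCell} {a1 a2 : ℚ} {M2 : ℕ} {pi : ℕ × ℕ} {B : Box} {e : RExpr} {D : SD}
    (hbox : cellBox c a1 a2 M2 pi = some B) (h : endCheckB B pi e D = true) : EndHolds c a1 a2 M2 pi e D := by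
  intro B' hB' x hx
  rw [hbox] at hB'
  cases hB'
  unfold endCheckB at h
  split at h
  · exact absurd h (by simp)
  · rename_i A hA
    exact holds_of_SDincl h (sdEnclose_sound (holds_envC hx) e hA)

/-- ★ FINAL CHECK ON A LITERAL STAGED BOX. -/
def finalCheckB (B : Box) (pi : ℕ × ℕ) (ends : List (SD × SD)) (cmin : ℚ) : Bool :=
  let XF := envF (envC B) (ends.map fun p => p.1.hull p.2)
  let D2 := incrI (B.toIvl 2) (midI (B.toIvl 2))
  let D3 := incrI (B.toIvl 3) (midI (B.toIvl 3))
  match sdEnclose pi.1 pi.2 XF (marginE cmin), sdEnclose pi.1 pi.2 XF (.neg fP), sdEnclose pi.1 pi.2 XF (.neg UpE) with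
  | some M, some P, some U => decide (M.ub D2 D3 ≤ 0) && decide (P.ub D2 D3 ≤ -1) && decide (U.ub D2 D3 ≤ -1)
  | _, _, _ => false

/-- the final check through the literal box. -/
theorem finalCheckS_of_B {c : L2.NamedCell} {a1 a2 : ℚ} {M2 : ℕ} {pi : ℕ × ℕ} {B : Box} {ends : List (SD × SD)} {cmin : ℚ}
    (hbox : cellBox c a1 a2 M2 pi = some B) (h : finalCheckB B pi ends cmin = true) :
    finalCheckS c a1 a2 M2 pi ends cmin = true := by
  unfold finalCheckS; rw [hbox]; exact h

/-- the objects at the true point and their centre companions are enclosed by the hulls of the end data. -/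
theorem holds_objs {δ2 δ3 : ℝ} {x z : ℕ → ℝ} :
    ∀ (specs : List (RExpr × RExpr)) (ends : List (SD × SD)) (vs : List ℝ), ends.length = specs.length →
      vs.length = specs.length →
      (∀ j (hj : j < specs.length) (hj' : j < ends.length), (ends[j].1).Holds δ2 δ3 ((specs[j].1).eval x) ((specs[j].1).eval z) ∧
        (ends[j].2).Holds δ2 δ3 ((specs[j].2).eval x) ((specs[j].2).eval z)) →
      (∀ j (hj : j < specs.length) (hj' : j < vs.length), (specs[j].1).eval x ≤ vs[j] ∧ vs[j] ≤ (specs[j].2).eval x) →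
      ∃ ws : List ℝ, ws.length = specs.length ∧ ∀ j, ((ends.map fun p => p.1.hull p.2).getD j (SD.const 0)).Holds δ2 δ3
        (vs.getD j 0) (ws.getD j 0)
  | [], [], [], _, _, _, _ => ⟨[], rfl, fun j => by simpa using SD.const_holds (δ2 := δ2) (δ3 := δ3) 0⟩
  | s :: rest, d :: ends, v :: vs, hl, hvl, hends, hob => by
    have hl' : ends.length = rest.length := by simpa using hl
    have hvl' : vs.length = rest.length := by simpa using hvl
    obtain ⟨ws, hws, hrest⟩ := holds_objs rest ends vs hl' hvl'
      (fun j hj hj' => hends (j + 1) (by simpa using hj) (by simpa using hj'))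
      (fun j hj hj' => hob (j + 1) (by simpa using hj) (by simpa using hj'))
    obtain ⟨h1, h2⟩ := hends 0 (by simp) (by simp)
    obtain ⟨hv1, hv2⟩ := hob 0 (by simp) (by simp)
    simp only [List.getElem_cons_zero] at h1 h2 hv1 hv2
    obtain ⟨w, hw⟩ := holdsHull_of_between h1 h2 hv1 hv2
    refine ⟨w :: ws, by simp [hws], fun j => ?_⟩
    cases j with
    | zero => simpa using hw
    | succ j => simpa using hrest j
  | [], _ :: _, _, hl, _, _, _ => by simp at hl
  | [], [], _ :: _, _, hvl, _, _ => by simp at hvl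
  | _ :: _, [], _, hl, _, _, _ => by simp at hl
  | _ :: _, _ :: _, [], _, hvl, _, _ => by simp at hvl

/-- ★★ **SOUNDNESS OF THE FIRST-ORDER CELL CHECK (interval layer)**: if every end condition holds and the final check passes, then
for every real vector `X` in the cell box on its first sixteen coordinates whose staged coordinates satisfy the specs, and
every list of five object values bracketed by `objSpecsC` at `X`, the final vector `y = finalVec X vs` satisfies `1 ≤ y₆`,
`1 ≤ U′(y)` and `cmin·U′(y) ≤ N₁′(y)` — the same conclusion as `n1CellCheckC_sound`. -/
theorem cellCheckS_sound (c : L2.NamedCell) (a1 a2 : ℚ) (M2 : ℕ) (cmin : ℚ) (pi : ℕ × ℕ) (ends : List (SD × SD))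
    (hlen : ends.length = (objSpecsC M2).length)
    (hends : ∀ j (hj : j < (objSpecsC M2).length) (hj' : j < ends.length),
      EndHolds c a1 a2 M2 pi ((objSpecsC M2)[j].1) (ends[j].1) ∧ EndHolds c a1 a2 M2 pi ((objSpecsC M2)[j].2) (ends[j].2))
    (hfin : finalCheckS c a1 a2 M2 pi ends cmin = true) (hv : specsVarsOkC M2 = true) (X : ℕ → ℝ)
    (hX : PMem (c.box a1 a2) X)
    (hsp : ∀ j (hj : j < (specs M2).length), ((specs M2)[j].1).eval X ≤ X (16 + j) ∧ X (16 + j) ≤ ((specs M2)[j].2).eval X)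
    (vs : List ℝ) (hvl : vs.length = 5)
    (hob : ∀ j (hj : j < (objSpecsC M2).length) (hj' : j < vs.length),
      ((objSpecsC M2)[j].1).eval X ≤ vs[j] ∧ vs[j] ≤ ((objSpecsC M2)[j].2).eval X) :
    1 ≤ finalVec X vs 6 ∧ 1 ≤ UpE.eval (finalVec X vs) ∧
      (cmin : ℝ) * UpE.eval (finalVec X vs) ≤ N1pE.eval (finalVec X vs) := by
  have hlen0 : (c.box a1 a2).length = 16 := by simp [L2.NamedCell.box]
  simp only [specsVarsOkC, Bool.and_eq_true] at hv
  obtain ⟨hv1, hv2⟩ := hv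
  have hS : SpecsHold X (c.box a1 a2).length (specs M2) := by
    rw [hlen0]; exact specsHold_of X (specs M2) 16 hv1 hsp
  unfold finalCheckS at hfin
  split at hfin
  · exact absurd hfin (by simp)
  · rename_i B hB
    obtain ⟨hPB, hlenB⟩ := extendBox_sound pi.1 pi.2 X (specs M2) _ B hB hX hS
    have hO : ObjsHold X B.length (objSpecsC M2) vs := by
      rw [hlenB, hlen0]
      exact objsHold_of X _ (objSpecsC M2) vs (by rw [hvl]; simp [objSpecsC]) hv2 hob
    -- the stage-1 pair
    have hn17 : 17 ≤ B.length := by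
      rw [hlenB, hlen0]; simp only [specs, List.length_append, List.length_cons, List.length_nil, List.length_map]; omega
    obtain ⟨x₁, hx₁⟩ : ∃ x₁ : ℕ → ℝ, x₁ = trunc X B.length := ⟨_, rfl⟩
    have hmem : B.mem x₁ := by rw [hx₁]; exact mem_trunc hPB
    have hXeq : ∀ i, i < B.length → X i = x₁ i := fun i hi => by rw [hx₁]; unfold trunc; rw [if_pos hi]
    have hcen : ∀ i, i ≠ 2 → i ≠ 3 → cenPt B x₁ i = x₁ i := fun i h2 h3 => by
      unfold cenPt; rw [Function.update_of_ne h3, Function.update_of_ne h2]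
    -- object values vs their end terms at x₁ (truncation is invisible to the specs)
    have hvars : ∀ j (hj : j < (objSpecsC M2).length), varsBelow B.length ((objSpecsC M2)[j].1) = true ∧
        varsBelow B.length ((objSpecsC M2)[j].2) = true := by
      intro j hj
      rw [hlenB, hlen0]
      have := List.all_eq_true.1 hv2 _ (List.getElem_mem hj)
      simpa [Bool.and_eq_true] using this
    have hob₁ : ∀ j (hj : j < (objSpecsC M2).length) (hj' : j < vs.length),
        ((objSpecsC M2)[j].1).eval x₁ ≤ vs[j] ∧ vs[j] ≤ ((objSpecsC M2)[j].2).eval x₁ := by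
      intro j hj hj'
      obtain ⟨hva, hvb⟩ := hvars j hj
      rw [hx₁, eval_trunc _ hva, eval_trunc _ hvb]
      exact hob j hj hj'
    have hends₁ : ∀ j (hj : j < (objSpecsC M2).length) (hj' : j < ends.length),
        (ends[j].1).Holds (x₁ 2 - midI (B.toIvl 2)) (x₁ 3 - midI (B.toIvl 3)) (((objSpecsC M2)[j].1).eval x₁)
          (((objSpecsC M2)[j].1).eval (cenPt B x₁)) ∧
        (ends[j].2).Holds (x₁ 2 - midI (B.toIvl 2)) (x₁ 3 - midI (B.toIvl 3)) (((objSpecsC M2)[j].2).eval x₁)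
          (((objSpecsC M2)[j].2).eval (cenPt B x₁)) := by
      intro j hj hj'
      obtain ⟨h1, h2⟩ := hends j hj hj'
      exact ⟨h1 B hB x₁ hmem, h2 B hB x₁ hmem⟩
    obtain ⟨ws, hws, hobjs⟩ := holds_objs (x := x₁) (z := cenPt B x₁) (objSpecsC M2) ends vs hlen
      (by rw [hvl]; simp [objSpecsC]) hends₁ hob₁
    -- the final-stage pair `(finalVec X vs, finalVec (cenPt B x₁) ws)`
    have hXF : ∀ i, (envF (envC B) (ends.map fun p => p.1.hull p.2) i).Holds (x₁ 2 - midI (B.toIvl 2))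
        (x₁ 3 - midI (B.toIvl 3)) (finalVec X vs i) (finalVec (cenPt B x₁) ws i) := by
      intro i
      unfold envF
      by_cases h4 : i < 4
      · rw [if_pos h4]
        have hyi : finalVec X vs i = x₁ i := by
          unfold finalVec
          interval_cases i <;> simp [hXeq 0 (by omega), hXeq 1 (by omega), hXeq 2 (by omega), hXeq 3 (by omega)]
        have hyzi : finalVec (cenPt B x₁) ws i = cenPt B x₁ i := by
          unfold finalVec
          interval_cases i <;> simp
        rw [hyi, hyzi]; exact holds_envC hmem i
      · rw [if_neg h4]
        by_cases h5 : i = 4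
        · subst h5
          rw [if_pos rfl]
          have hyi : finalVec X vs 4 = x₁ 16 := by unfold finalVec; simp [hXeq 16 (by omega)]
          have hyzi : finalVec (cenPt B x₁) ws 4 = x₁ 16 := by unfold finalVec; simp [hcen 16 (by decide) (by decide)]
          rw [hyi, hyzi]
          have h16 := holds_envC hmem 16
          rw [hcen 16 (by decide) (by decide)] at h16
          exact h16
        · rw [if_neg h5]
          have hyi : finalVec X vs i = vs.getD (i - 5) 0 := by
            unfold finalVec
            simp [show i ≠ 0 by omega, show i ≠ 1 by omega, show i ≠ 2 by omega, show i ≠ 3 by omega, h5]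
          have hyzi : finalVec (cenPt B x₁) ws i = ws.getD (i - 5) 0 := by
            unfold finalVec
            simp [show i ≠ 0 by omega, show i ≠ 1 by omega, show i ≠ 2 by omega, show i ≠ 3 by omega, h5]
          rw [hyi, hyzi]; exact hobjs (i - 5)
    have hD2 := incr_mem hmem 2
    have hD3 := incr_mem hmem 3
    simp only at hfin
    split at hfin
    · rename_i M P U hM hP hU
      simp only [Bool.and_eq_true, decide_eq_true_eq] at hfin
      obtain ⟨⟨hM0, hP0⟩, hU0⟩ := hfin
      have eM := (sdEnclose_bounds hXF hD2 hD3 _ hM).2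
      have eP := (sdEnclose_bounds hXF hD2 hD3 _ hP).2
      have eU := (sdEnclose_bounds hXF hD2 hD3 _ hU).2
      have hM1 : (marginE cmin).eval (finalVec X vs) ≤ 0 := eM.trans (by exact_mod_cast hM0)
      have hP1 : (RExpr.neg fP).eval (finalVec X vs) ≤ ((-1 : ℚ) : ℝ) := eP.trans (by exact_mod_cast hP0)
      have hU1 : (RExpr.neg UpE).eval (finalVec X vs) ≤ ((-1 : ℚ) : ℝ) := eU.trans (by exact_mod_cast hU0)
      simp only [RExpr.eval, fP, Rat.cast_neg, Rat.cast_one] at hP1 hU1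
      simp only [marginE, RExpr.eval, cst] at hM1
      refine ⟨by linarith, by linarith, by linarith⟩
    · exact absurd hfin (by simp)

end Summit.HubbardSuperconductivity.HubbardSuperconductivity.Theorems.AnisotropyChord.Transfer.Fibre3.L2.N1
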